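import Mathlib
import HarnessLib
import Summits.Ventures.LatticeQCDFlow.Exactness.IMHRejectionFallbackBias

/-!
# LatticeQCDFlow / Exactness — TWO MORE REJECTION SHORTCUTS THAT BIAS THE FLOW SAMPLER: FORCING the next flow draw through after a
# rejection, and RECORDING ONLY THE ACCEPTED configurations (equivalently: stopping at the first acceptance)

HONEST FRAMING: exact (Metropolis-corrected) sampling algorithms for lattice gauge theory;
figures of merit are autocorrelation/cost numbers at stated couplings and volumes; no
continuum-physics claim.

Venture `LatticeQCDFlow` (cell pub-lqcd), topic `Exactness`, FANOUT row 30 (lean-1 GEN-43, theme SECOND CHANCES; sequel of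
`IMHNaiveRetryBias` ∕ `IMHRejectionFallbackBias`).  NEW WORK of the cell; no definition is introduced, nothing is cited as a fact.
Tree inputs: `IMHRejectionFallbackBias.fallback_bind_apply_add` (the defect identity of a rejection-triggered fallback), the `Bool`
bookkeeping `NaiveRetryWitness.*` of `IMHNaiveRetryBias`, `IMHNaiveRetryBias.lintegral_min_weight_eq`.  Related tree results NAMED: the
sequence of ACCEPTED states is a Markov chain whose invariant law is the TILT `A·π/∫A dπ`, not `π` (`Scoring.IMHAcceptanceRecordJumpKernel`:
`imhJump_invariant` for `imhTilt`), and the sojourn-reweighted estimator that repairs it (`Scoring.IMHAcceptanceRecordJumpReweighting`).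
Printed counterparts NAMED ONLY: Douc–Robert, Ann. Statist. 39 (2011) Lemma 1 (accepted values form a Markov chain with kernel `a q/A`).

## Setting (general measurable `Ω`; flow law `q`; weight `w > 0`; `a`, `A`, `π = w·q` as in `IMHKernel`; `ρ = (1 − A)·π`)

* FORCED ACCEPTANCE ("cap the holding time at one: if the flow draw is rejected, take the next flow draw unconditionally"): ANY kernel with
  `K(x, B) = ∫_B a(x, y) q(dy) + (1 − A(x))·q(B)` (hypothesis `hK`) — the rejection-triggered fallback of `IMHRejectionFallbackBias` with
  `L = ` the flow itself, which is NOT `π`-invariant.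
* ACCEPTED-ONLY RECORDING ("drop the repeats"; "run until the first acceptance and output it"): ANY kernel with
  `J(x, B) = A(x)⁻¹·∫_B a(x, y) q(dy)` (hypothesis `hJ`) — the law of the next ACCEPTED draw.

## Results [all ours]

* **`forcedAccept_bind_apply_add`**: `(πK)(B) + ρ(B) = π(B) + ρ(Ω)·q(B)` — exact iff the FLOW EQUALS THE NORMALISED REJECTION-WEIGHTED
  TARGET `ρ/ρ(Ω)` (never, for an imperfect flow: `ρ` sits on the heavy configurations the flow under-proposes).
* **`forcedAccept_not_invariant`** (witness `Bool`, `q` uniform, `w = (1, 2)`): `(πK)({false}) = 5/8 ≠ 1/2`.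
* `imhAcceptMass_pos`: `A(x) > 0`; **`acceptedOnly_bind_apply` ∕ `target_eq_landing_form`**:
  `(πJ)(B) = ∫_B ∫ A(x)⁻¹·min(w x, w y) q(dx) q(dy)` while `π(B) = ∫_B ∫ A(y)⁻¹·min(w x, w y) q(dx) q(dy)` — the SAME launch-versus-land structure
  as the naive retry's defect (`IMHNaiveRetryBias`) with `A⁻¹` in place of `1 − A`: recording only accepted configurations is exact iff
  `A⁻¹` can be moved across the symmetric flux, and it over-weights configurations reached FROM sticky (heavy) states.
* **`acceptedOnly_not_invariant`** (same witness): `(πJ)({false}) = 7/12 ≠ 1/2` — dropping the repeated (rejected-step) rows of an exact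
  flow-sampler run, or reporting the state at the first acceptance, biases toward the light configurations by `1/12` here.
-/

namespace Summit.Ventures.LatticeQCDFlow.Exactness

open MeasureTheory ProbabilityTheory
open scoped ENNReal

variable {Ω : Type*} [MeasurableSpace Ω] {q : Measure Ω} [IsProbabilityMeasure q] {w : Ω → ℝ}

/-! ## §1 Forced acceptance after a rejection -/

/-- **THE DEFECT IDENTITY OF FORCED ACCEPTANCE**: `(πK)(B) + ρ(B) = π(B) + ρ(Ω)·q(B)` with `ρ = (1 − A)·π`. [ours] -/
theorem forcedAccept_bind_apply_add (hw : Measurable w) (hw0 : ∀ x, 0 < w x) (K : Kernel Ω Ω)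
    (hK : ∀ (x : Ω) {B : Set Ω}, MeasurableSet B → K x B =
      ∫⁻ y in B, imhAcceptE w x y ∂q + (1 - imhAcceptMass q w x) * q B)
    {B : Set Ω} (hB : MeasurableSet B) :
    ((q.withDensity fun y => ENNReal.ofReal (w y)).bind K) B +
        (q.withDensity fun y => ENNReal.ofReal (w y) * (1 - imhAcceptMass q w y)) B =
      (q.withDensity fun y => ENNReal.ofReal (w y)) B +
        (q.withDensity fun y => ENNReal.ofReal (w y) * (1 - imhAcceptMass q w y)) Set.univ * q B := by
  have h := fallback_bind_apply_add hw hw0 (Kernel.const Ω q) K (fun x B hB => by rw [hK x hB, Kernel.const_apply]) hB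
  have hc : ((q.withDensity fun y => ENNReal.ofReal (w y) * (1 - imhAcceptMass q w y)).bind (Kernel.const Ω q)) B =
      (q.withDensity fun y => ENNReal.ofReal (w y) * (1 - imhAcceptMass q w y)) Set.univ * q B := by
    rw [Measure.bind_apply hB (Kernel.aemeasurable _)]
    simp only [Kernel.const_apply]
    rw [lintegral_const, mul_comm]
  rwa [hc] at h

/-- `K(x, Ω) = 1` for the forced-acceptance kernel. [ours, bookkeeping] -/
theorem forcedAccept_isMarkovKernel (K : Kernel Ω Ω)
    (hK : ∀ (x : Ω) {B : Set Ω}, MeasurableSet B → K x B =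
      ∫⁻ y in B, imhAcceptE w x y ∂q + (1 - imhAcceptMass q w x) * q B) :
    IsMarkovKernel K :=
  fallback_isMarkovKernel (Kernel.const Ω q) K (fun x B hB => by rw [hK x hB, Kernel.const_apply])

section ForcedWitness

variable {q : Measure Bool} {w : Bool → ℝ}

/-- **THE WITNESS, QUANTIFIED**: one forced-acceptance step from `π` puts mass `5/8` on `false` (target `1/2`). [ours] -/
theorem forcedAccept_bind_apply_false (hq : ∀ b, q {b} = ENNReal.ofReal 2⁻¹) (hwf : w false = 1) (hwt : w true = 2)
    (K : Kernel Bool Bool)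
    (hK : ∀ (x : Bool) {B : Set Bool}, MeasurableSet B → K x B =
      ∫⁻ y in B, imhAcceptE w x y ∂q + (1 - imhAcceptMass q w x) * q B) :
    ((q.withDensity fun y => ENNReal.ofReal (w y)).bind K) {false} = ENNReal.ofReal (5 / 8) := by
  obtain ⟨hff, -, htf, -⟩ := NaiveRetryWitness.imhAcceptE_eq hwf hwt
  obtain ⟨hAf, hAt⟩ := NaiveRetryWitness.imhAcceptMass_eq hq hwf hwt
  obtain ⟨hπf, hπt⟩ := NaiveRetryWitness.target_eq hq hwf hwt
  have hKf : K false {false} = ENNReal.ofReal 2⁻¹ := by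
    rw [hK false (measurableSet_singleton _), NaiveRetryWitness.setLIntegral_false_eq hq, hff, hAf, tsub_self, one_mul,
      zero_mul, add_zero]
  have hKt : K true {false} = ENNReal.ofReal (3 / 8) := by
    rw [hK true (measurableSet_singleton _), NaiveRetryWitness.setLIntegral_false_eq hq, htf, hAt, hq,
      ← ENNReal.ofReal_one, ← ENNReal.ofReal_sub _ (by norm_num), ← ENNReal.ofReal_mul (by norm_num),
      ← ENNReal.ofReal_mul (by norm_num), ← ENNReal.ofReal_add (by norm_num) (by norm_num)]
    norm_num
  rw [Measure.bind_apply (measurableSet_singleton _) (Kernel.aemeasurable _), lintegral_fintype, Fintype.sum_bool,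
    hKf, hKt, hπf, hπt, mul_one, ← ENNReal.ofReal_mul (by norm_num), ← ENNReal.ofReal_add (by norm_num) (by norm_num)]
  norm_num

/-- **FORCED ACCEPTANCE IS NOT EXACT**: for EVERY kernel realising "take the next flow draw unconditionally after a rejection", `π` is not
invariant (two-point witness). [ours] -/
theorem forcedAccept_not_invariant (hq : ∀ b, q {b} = ENNReal.ofReal 2⁻¹) (hwf : w false = 1) (hwt : w true = 2)
    (K : Kernel Bool Bool)
    (hK : ∀ (x : Bool) {B : Set Bool}, MeasurableSet B → K x B =
      ∫⁻ y in B, imhAcceptE w x y ∂q + (1 - imhAcceptMass q w x) * q B) :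
    ¬ Kernel.Invariant K (q.withDensity fun y => ENNReal.ofReal (w y)) := by
  intro h
  have h1 := congrArg (fun μ : Measure Bool => μ {false}) h.def
  rw [forcedAccept_bind_apply_false hq hwf hwt K hK, (NaiveRetryWitness.target_eq hq hwf hwt).1,
    ENNReal.ofReal_eq_ofReal_iff (by norm_num) (by norm_num)] at h1
  norm_num at h1

end ForcedWitness

/-! ## §2 Accepted-only recording: the law of the next accepted draw -/

/-- **`A(x) > 0`** for a positive weight (the flow proposal is accepted with positive probability from everywhere). [ours] -/
theorem imhAcceptMass_pos (hw : Measurable w) (hw0 : ∀ x, 0 < w x) (x : Ω) : 0 < imhAcceptMass q w x := by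
  rw [imhAcceptMass, lintegral_pos_iff_support ((measurable_imhAcceptE hw).of_uncurry_left)]
  have : Function.support (fun y => imhAcceptE w x y) = Set.univ := by
    ext y
    simp only [Function.mem_support, ne_eq, Set.mem_univ, iff_true, imhAcceptE, ENNReal.ofReal_eq_zero, not_le, imhAccept]
    exact lt_min zero_lt_one (div_pos (hw0 y) (hw0 x))
  rw [this, measure_univ]
  exact zero_lt_one

omit [IsProbabilityMeasure q] in
/-- `A(x) ≠ ∞`. [ours, bookkeeping] -/
theorem imhAcceptMass_ne_top' [IsProbabilityMeasure q] (x : Ω) : imhAcceptMass q w x ≠ ⊤ :=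
  ne_top_of_le_ne_top ENNReal.one_ne_top (imhAcceptMass_le_one q w x)

/-- **THE LAW AFTER ONE ACCEPTED-ONLY STEP FROM `π`**: `(πJ)(B) = ∫_B ∫ A(x)⁻¹·min(w x, w y) q(dx) q(dy)` — the factor `A⁻¹` at the LAUNCHING
point. [ours] -/
theorem acceptedOnly_bind_apply (hw : Measurable w) (hw0 : ∀ x, 0 < w x) (J : Kernel Ω Ω)
    (hJ : ∀ (x : Ω) {B : Set Ω}, MeasurableSet B → J x B = (imhAcceptMass q w x)⁻¹ * ∫⁻ y in B, imhAcceptE w x y ∂q)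
    {B : Set Ω} (hB : MeasurableSet B) :
    ((q.withDensity fun y => ENNReal.ofReal (w y)).bind J) B =
      ∫⁻ y in B, ∫⁻ x, (imhAcceptMass q w x)⁻¹ * ENNReal.ofReal (min (w x) (w y)) ∂q ∂q := by
  have hd : Measurable fun x => ENNReal.ofReal (w x) := hw.ennreal_ofReal
  have ha : Measurable (Function.uncurry (imhAcceptE w)) := measurable_imhAcceptE hw
  have hAi : Measurable fun x => (imhAcceptMass q w x)⁻¹ := (measurable_imhAcceptMass q hw).inv
  have hmin : Measurable (Function.uncurry fun x y : Ω => (imhAcceptMass q w x)⁻¹ * ENNReal.ofReal (min (w x) (w y))) :=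
    (hAi.comp measurable_fst).mul ((hw.comp measurable_fst).min (hw.comp measurable_snd)).ennreal_ofReal
  rw [Measure.bind_apply hB (Kernel.aemeasurable _), lintegral_withDensity_eq_lintegral_mul _ hd (Kernel.measurable_coe J hB)]
  simp only [Pi.mul_apply]
  have hpt : ∀ x, ENNReal.ofReal (w x) * J x B = ∫⁻ y in B, (imhAcceptMass q w x)⁻¹ * ENNReal.ofReal (min (w x) (w y)) ∂q := by
    intro x
    have hm2 : Measurable fun y => ENNReal.ofReal (w x) * imhAcceptE w x y := measurable_const.mul ha.of_uncurry_left
    rw [hJ x hB, mul_left_comm, ← lintegral_const_mul _ (ha.of_uncurry_left), ← lintegral_const_mul _ hm2]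
    refine lintegral_congr fun y => ?_
    rw [ofReal_mul_imhAcceptE hw0 x y]
  simp_rw [hpt]
  exact lintegral_lintegral_swap (hmin.aemeasurable (μ := q.prod (q.restrict B)))

/-- **`π` ITSELF IN THE SAME FORM**: `π(B) = ∫_B ∫ A(y)⁻¹·min(w x, w y) q(dx) q(dy)` — the factor `A⁻¹` at the LANDING point. [ours] -/
theorem target_eq_landing_form (hw : Measurable w) (hw0 : ∀ x, 0 < w x) {B : Set Ω} (hB : MeasurableSet B) :
    (q.withDensity fun y => ENNReal.ofReal (w y)) B =
      ∫⁻ y in B, ∫⁻ x, (imhAcceptMass q w y)⁻¹ * ENNReal.ofReal (min (w x) (w y)) ∂q ∂q := by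
  have hmin : ∀ y, Measurable fun x => ENNReal.ofReal (min (w x) (w y)) := fun y => (hw.min measurable_const).ennreal_ofReal
  rw [withDensity_apply _ hB]
  refine lintegral_congr fun y => ?_
  rw [lintegral_const_mul _ (hmin y), lintegral_min_weight_eq hw hw0 y, mul_left_comm,
    ENNReal.inv_mul_cancel (imhAcceptMass_pos hw hw0 y).ne' (imhAcceptMass_ne_top' y), mul_one]

section AcceptedOnlyWitness

variable {q : Measure Bool} {w : Bool → ℝ}

/-- **THE WITNESS, QUANTIFIED**: one accepted-only step from `π` puts mass `7/12` on `false` (target `1/2 = 6/12`). [ours] -/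
theorem acceptedOnly_bind_apply_false (hq : ∀ b, q {b} = ENNReal.ofReal 2⁻¹) (hwf : w false = 1) (hwt : w true = 2)
    (J : Kernel Bool Bool)
    (hJ : ∀ (x : Bool) {B : Set Bool}, MeasurableSet B → J x B = (imhAcceptMass q w x)⁻¹ * ∫⁻ y in B, imhAcceptE w x y ∂q) :
    ((q.withDensity fun y => ENNReal.ofReal (w y)).bind J) {false} = ENNReal.ofReal (7 / 12) := by
  obtain ⟨hff, -, htf, -⟩ := NaiveRetryWitness.imhAcceptE_eq hwf hwt
  obtain ⟨hAf, hAt⟩ := NaiveRetryWitness.imhAcceptMass_eq hq hwf hwt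
  obtain ⟨hπf, hπt⟩ := NaiveRetryWitness.target_eq hq hwf hwt
  have hJf : J false {false} = ENNReal.ofReal 2⁻¹ := by
    rw [hJ false (measurableSet_singleton _), NaiveRetryWitness.setLIntegral_false_eq hq, hff, hAf, inv_one, one_mul, one_mul]
  have hJt : J true {false} = ENNReal.ofReal (1 / 3) := by
    rw [hJ true (measurableSet_singleton _), NaiveRetryWitness.setLIntegral_false_eq hq, htf, hAt,
      ENNReal.ofReal_inv_of_pos (by norm_num) |>.symm, ← ENNReal.ofReal_mul (by norm_num), ← ENNReal.ofReal_mul (by norm_num)]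
    norm_num
  rw [Measure.bind_apply (measurableSet_singleton _) (Kernel.aemeasurable _), lintegral_fintype, Fintype.sum_bool,
    hJf, hJt, hπf, hπt, mul_one, ← ENNReal.ofReal_mul (by norm_num), ← ENNReal.ofReal_add (by norm_num) (by norm_num)]
  norm_num

/-- **ACCEPTED-ONLY RECORDING IS NOT EXACT**: for EVERY kernel realising "the next accepted flow draw", `π` is not invariant — keeping only
the accepted configurations of an exact run (or stopping at the first acceptance) samples the wrong law (two-point witness). [ours] -/
theorem acceptedOnly_not_invariant (hq : ∀ b, q {b} = ENNReal.ofReal 2⁻¹) (hwf : w false = 1) (hwt : w true = 2)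
    (J : Kernel Bool Bool)
    (hJ : ∀ (x : Bool) {B : Set Bool}, MeasurableSet B → J x B = (imhAcceptMass q w x)⁻¹ * ∫⁻ y in B, imhAcceptE w x y ∂q) :
    ¬ Kernel.Invariant J (q.withDensity fun y => ENNReal.ofReal (w y)) := by
  intro h
  have h1 := congrArg (fun μ : Measure Bool => μ {false}) h.def
  rw [acceptedOnly_bind_apply_false hq hwf hwt J hJ, (NaiveRetryWitness.target_eq hq hwf hwt).1,
    ENNReal.ofReal_eq_ofReal_iff (by norm_num) (by norm_num)] at h1
  norm_num at h1

end AcceptedOnlyWitness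

end Summit.Ventures.LatticeQCDFlow.Exactness
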